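import Mathlib

/-!
# Crux `WordLengthQP` (stmt-ValiantsHypothesis-6623), line `positive-monoid-exits` —
THEOREM U, part 1/3: the all-`t` continuant walk (lead c6)

The three files `…UnivariateWalk`, `…UnivariateSandwich`, `…UnivariateBoundedExits` prove
**THEOREM U** (lead c6): for every `d ≥ 1` and real `c`, the univariate transvection `E₀₂(c·t^d)`
is `Q₁⁻¹ · R · Q₂⁻¹` with `Q₁, R, Q₂` products of POSITIVE ADJACENT letters (`x₁(t) = E₀₁(t)`,
`y₁(t) = E₁₀(t)`, taps `x₂(a) = E₁₂(a)`, `x₂(a t)`, `a > 0`), hence has alternation number `≤ 3`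
w.r.t. Lusztig's positive monoid and a real word with at most `16` exits — uniformly in `d`.
Consequently the univariate shadow of the line's `MonomialExitLadder` is false
(`not_univariate_exits_unbounded`, part 3), and every lower bound for the sign budget `S` of the line
beyond `16` exits has to be genuinely multivariate.

Mechanism (parabolic submodel `SL₂ ⋉ V`, row 2 fixed): along the walk `x₁(t) y₁(t) x₁(t) y₁(t) ⋯`
columns 0 and 1 of the walk matrix run through ONE continuant sequence
`W 0 = e₁, W 1 = e₀, W (n+2) = W n + t • W (n+1)`; a tap `x₂(ρ)` after state `m` adds `ρ · W(2m)`
to column 2; and `t^a • W a = Σ_m (-1)^(a+m) C(a,m) • W (2m)` (this file, `ubW_binomial`), so the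
correction `c t^d · (column 0 of Q₁)` demanded by `R = Q₁ E₀₂(c t^d) Q₂` is an INTEGER combination of
tap states: positive coefficients become taps of `R`, negative ones taps of `Q₁, Q₂`.

Vocabulary (written out in every statement; the files introduce NO definitions): the letter matrix
of `l = (i, j, c, o)` is `Matrix.transvection i j (C c * o.elim 1 X)` (the route's word predicate over
`σ = Fin 1`, `t = X 0`); a letter is POSITIVE ADJACENT (not an exit) iff `0 < c ∧ |i - j| = 1`; the TAPS
at a state are the letters `x₂(a) = (1,2,a,none)`, `x₂(b t) = (1,2,b,some 0)` written only when `a > 0`,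
`b > 0`; a TAP WORD with `K` double steps is `taps(0) ++ ⋯ ++ [x₁(t)] ++ taps(k+1) ++ [y₁(t)] ++ ⋯`
(`x₁(t) = (0,1,1,some 0)`, `y₁(t) = (1,0,1,some 0)`); the WALK MATRIX is `(x₁(t) y₁(t))^K`; the GARBAGE
COLUMN of a vector `v` is `vecMulVec v e₂`; the continuant STATE SEQUENCE is any
`W : ℕ → Fin 3 → ℝ[t]` with `W 0 = e₁, W 1 = e₀, W (n+2) = W n + t • W (n+1)` (hypothesis `hW`).

This part: the binomial expansion along an abstract continuant sequence, the walk matrix, its row 2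
and columns 0, 1, and `A_J *ᵥ W n = W (2J + n)` (registered calibration stub `stub_univariateWalkTranslation`).  References: Ben-Or–Cleve 1992 (elementary words),
Lusztig 1994 / Fomin–Zelevinsky 1999 (positive monoid); the identities are folklore linear algebra.
-/

-- `Summit.ValiantsHypothesis.ValiantsHypothesis.…` is the tree's mandated single-conjunct layout
-- (Sub = Summit), so the duplicated namespace component is intended.
set_option linter.dupNamespace false

noncomputable section

namespace Summit.ValiantsHypothesis.ValiantsHypothesis.Cruxes.WordLengthQP.PositiveMonoidExits

open Matrix

section Continuant

variable {R : Type*} [CommRing R]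

/-- `t • W (n+1) = W (n+2) - W n` for a continuant sequence `W (n+2) = W n + t • W (n+1)`. [folklore] -/
theorem ubW_smul (t : R) (W : ℕ → Fin 3 → R) (hW : ∀ n, W (n + 2) = W n + t • W (n + 1)) (n : ℕ) :
    t • W (n + 1) = W (n + 2) - W n := by
  rw [hW]; abel

/-- The third coordinate of every state of the walk `W 0 = e₁, W 1 = e₀, W (n+2) = W n + t • W (n+1)`
vanishes (the walk lives in the parabolic `SL₂ ⋉ V`). [folklore] -/
theorem ubW_two (t : R) (W : ℕ → Fin 3 → R)
    (hW : W 0 = Pi.single 1 1 ∧ W 1 = Pi.single 0 1 ∧ ∀ n, W (n + 2) = W n + t • W (n + 1)) (n : ℕ) :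
    W n 2 = 0 := by
  induction n using Nat.strong_induction_on with
  | _ n ih =>
    match n, ih with
    | 0, _ => simp [hW.1]
    | 1, _ => simp [hW.2.1]
    | (n + 2), ih =>
      rw [hW.2.2]
      simp [ih n (by omega), ih (n + 1) (by omega)]

/-- Pascal's rule for the signed binomials `(-1)^(a+m) C(a,m)`. [folklore] -/
theorem ubc_succ_succ (a m : ℕ) :
    ((-1 : R) ^ (a + 1 + (m + 1)) * ((a + 1).choose (m + 1) : R)) =
      (-1 : R) ^ (a + m) * (a.choose m : R) - (-1 : R) ^ (a + (m + 1)) * (a.choose (m + 1) : R) := by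
  simp only [Nat.choose_succ_succ, Nat.cast_add]
  ring

/-- The signed binomial at `m = 0` changes sign with `a`. [folklore] -/
theorem ubc_succ_zero (a : ℕ) :
    ((-1 : R) ^ (a + 1 + 0) * ((a + 1).choose 0 : R)) = - ((-1 : R) ^ (a + 0) * (a.choose 0 : R)) := by
  simp [pow_succ]

/-- The signed binomial vanishes above the diagonal. [folklore] -/
theorem ubc_lt (a m : ℕ) (h : a < m) : ((-1 : R) ^ (a + m) * (a.choose m : R)) = 0 := by
  simp [Nat.choose_eq_zero_of_lt h]

/-- **Binomial expansion along the walk**: `t^a • W (n + a) = Σ_{m ≤ a} (-1)^(a+m) C(a,m) • W (n + 2m)`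
for every continuant sequence (operator form: `t·S = S² - 1` on the sequence, so
`(t S)^a = (S² - 1)^a`). [folklore] -/
theorem ubW_binomial (t : R) (W : ℕ → Fin 3 → R) (hW : ∀ n, W (n + 2) = W n + t • W (n + 1)) (a : ℕ) :
    ∀ n : ℕ, t ^ a • W (n + a) =
      ∑ m ∈ Finset.range (a + 1), ((-1 : R) ^ (a + m) * (a.choose m : R)) • W (n + 2 * m) := by
  induction a with
  | zero => intro n; simp
  | succ a ih =>
    intro n
    have h1 : t ^ (a + 1) • W (n + (a + 1)) = t • (t ^ a • W ((n + 1) + a)) := by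
      rw [smul_smul, ← pow_succ', show n + (a + 1) = (n + 1) + a by ring]
    rw [h1, ih (n + 1), Finset.smul_sum]
    have h2 : ∀ m ∈ Finset.range (a + 1),
        t • (((-1 : R) ^ (a + m) * (a.choose m : R)) • W (n + 1 + 2 * m)) =
          ((-1 : R) ^ (a + m) * (a.choose m : R)) • W (n + 2 * (m + 1)) -
          ((-1 : R) ^ (a + m) * (a.choose m : R)) • W (n + 2 * m) := by
      intro m _
      rw [smul_comm, show n + 1 + 2 * m = (n + 2 * m) + 1 by ring, ubW_smul t W hW,
        show n + 2 * m + 2 = n + 2 * (m + 1) by ring, smul_sub]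
    rw [Finset.sum_congr rfl h2, Finset.sum_sub_distrib]
    rw [Finset.sum_range_succ' (fun m => ((-1 : R) ^ (a + 1 + m) * ((a + 1).choose m : R)) •
      W (n + 2 * m))]
    simp only [ubc_succ_succ, sub_smul, Finset.sum_sub_distrib, ubc_succ_zero, neg_smul,
      mul_zero, add_zero]
    rw [Finset.sum_range_succ (fun m => ((-1 : R) ^ (a + (m + 1)) * (a.choose (m + 1) : R)) •
        W (n + 2 * (m + 1))),
      ubc_lt a (a + 1) (Nat.lt_succ_self a), zero_smul, add_zero,
      Finset.sum_range_succ' (fun m => ((-1 : R) ^ (a + m) * (a.choose m : R)) • W (n + 2 * m))]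
    simp only [mul_zero, add_zero]
    abel

end Continuant

section Walk

/-- Taps are positive adjacent letters. [folklore] -/
theorem utaps_posadj (a b : ℝ) : ∀ l ∈ ((if (0 : ℝ) < a then [((1 : Fin 3), (2 : Fin 3), (a : ℝ), (none : Option (Fin 1)))] else []) ++
        (if (0 : ℝ) < b then [((1 : Fin 3), (2 : Fin 3), (b : ℝ), some (0 : Fin 1))] else [])), (0 < l.2.2.1 ∧ (l.1.val + 1 = l.2.1.val ∨ l.2.1.val + 1 = l.1.val)) := by
  intro l hl
  rcases List.mem_append.mp hl with hl | hl
  · split_ifs at hl with h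
    · simp only [List.mem_singleton] at hl; subst hl; exact ⟨h, by simp⟩
    · simp at hl
  · split_ifs at hl with h
    · simp only [List.mem_singleton] at hl; subst hl; exact ⟨h, by simp⟩
    · simp at hl

/-- Every letter of a tap word is positive adjacent (the word has no exits). [folklore] -/
theorem utword_posadj (τ0 τ1 : ℕ → ℝ) (K : ℕ) : ∀ l ∈ (((if (0 : ℝ) < (τ0 0) then [((1 : Fin 3), (2 : Fin 3), ((τ0 0) : ℝ), (none : Option (Fin 1)))] else []) ++
        (if (0 : ℝ) < (τ1 0) then [((1 : Fin 3), (2 : Fin 3), ((τ1 0) : ℝ), some (0 : Fin 1))] else [])) ++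
      (List.range (K)).flatMap (fun k =>
        [((0 : Fin 3), (1 : Fin 3), (1 : ℝ), some (0 : Fin 1))] ++
        ((if (0 : ℝ) < (τ0 (k + 1)) then [((1 : Fin 3), (2 : Fin 3), ((τ0 (k + 1)) : ℝ), (none : Option (Fin 1)))] else []) ++
        (if (0 : ℝ) < (τ1 (k + 1)) then [((1 : Fin 3), (2 : Fin 3), ((τ1 (k + 1)) : ℝ), some (0 : Fin 1))] else [])) ++
        [((1 : Fin 3), (0 : Fin 3), (1 : ℝ), some (0 : Fin 1))])), (0 < l.2.2.1 ∧ (l.1.val + 1 = l.2.1.val ∨ l.2.1.val + 1 = l.1.val)) := by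
  intro l hl
  rcases List.mem_append.mp hl with hl | hl
  · exact utaps_posadj _ _ l hl
  · obtain ⟨k, -, hk⟩ := List.mem_flatMap.mp hl
    rcases List.mem_append.mp hk with hk | hk
    · rcases List.mem_append.mp hk with hk | hk
      · simp only [List.mem_singleton] at hk; subst hk; exact ⟨by norm_num, by simp⟩
      · exact utaps_posadj _ _ l hk
    · simp only [List.mem_singleton] at hk; subst hk; exact ⟨by norm_num, by simp⟩

/-- Positive adjacent letters are off-diagonal (valid). [folklore] -/
theorem uposadj_valid (l : Fin 3 × Fin 3 × ℝ × Option (Fin 1)) (h : (0 < l.2.2.1 ∧ (l.1.val + 1 = l.2.1.val ∨ l.2.1.val + 1 = l.1.val))) : l.1 ≠ l.2.1 := by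
  intro he
  have := h.2
  rw [he] at this
  omega

/-- Tap words unfold one double step at a time. [folklore] -/
theorem utword_succ (τ0 τ1 : ℕ → ℝ) (K : ℕ) :
    (((if (0 : ℝ) < (τ0 0) then [((1 : Fin 3), (2 : Fin 3), ((τ0 0) : ℝ), (none : Option (Fin 1)))] else []) ++
        (if (0 : ℝ) < (τ1 0) then [((1 : Fin 3), (2 : Fin 3), ((τ1 0) : ℝ), some (0 : Fin 1))] else [])) ++
      (List.range (K + 1)).flatMap (fun k =>
        [((0 : Fin 3), (1 : Fin 3), (1 : ℝ), some (0 : Fin 1))] ++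
        ((if (0 : ℝ) < (τ0 (k + 1)) then [((1 : Fin 3), (2 : Fin 3), ((τ0 (k + 1)) : ℝ), (none : Option (Fin 1)))] else []) ++
        (if (0 : ℝ) < (τ1 (k + 1)) then [((1 : Fin 3), (2 : Fin 3), ((τ1 (k + 1)) : ℝ), some (0 : Fin 1))] else [])) ++
        [((1 : Fin 3), (0 : Fin 3), (1 : ℝ), some (0 : Fin 1))])) = (((if (0 : ℝ) < (τ0 0) then [((1 : Fin 3), (2 : Fin 3), ((τ0 0) : ℝ), (none : Option (Fin 1)))] else []) ++
        (if (0 : ℝ) < (τ1 0) then [((1 : Fin 3), (2 : Fin 3), ((τ1 0) : ℝ), some (0 : Fin 1))] else [])) ++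
      (List.range (K)).flatMap (fun k =>
        [((0 : Fin 3), (1 : Fin 3), (1 : ℝ), some (0 : Fin 1))] ++
        ((if (0 : ℝ) < (τ0 (k + 1)) then [((1 : Fin 3), (2 : Fin 3), ((τ0 (k + 1)) : ℝ), (none : Option (Fin 1)))] else []) ++
        (if (0 : ℝ) < (τ1 (k + 1)) then [((1 : Fin 3), (2 : Fin 3), ((τ1 (k + 1)) : ℝ), some (0 : Fin 1))] else [])) ++
        [((1 : Fin 3), (0 : Fin 3), (1 : ℝ), some (0 : Fin 1))])) ++
      ([((0 : Fin 3), (1 : Fin 3), (1 : ℝ), some (0 : Fin 1))] ++ ((if (0 : ℝ) < τ0 (K + 1) then [((1 : Fin 3), (2 : Fin 3), (τ0 (K + 1) : ℝ), (none : Option (Fin 1)))] else []) ++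
        (if (0 : ℝ) < τ1 (K + 1) then [((1 : Fin 3), (2 : Fin 3), (τ1 (K + 1) : ℝ), some (0 : Fin 1))] else [])) ++
       [((1 : Fin 3), (0 : Fin 3), (1 : ℝ), some (0 : Fin 1))]) := by
  simp only [List.range_succ, List.flatMap_append, List.flatMap_singleton, List.append_assoc]

/-- Right multiplication by `E_{i2}(c)` adds `c · col_i` to the garbage column. [folklore] -/
theorem u_mul_transvection_two (M : Matrix (Fin 3) (Fin 3) (MvPolynomial (Fin 1) ℝ)) (i : Fin 3) (c : (MvPolynomial (Fin 1) ℝ)) :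
    M * Matrix.transvection i 2 c = M + Matrix.vecMulVec (c • fun r => M r i : Fin 3 → MvPolynomial (Fin 1) ℝ) (Pi.single (2 : Fin 3) (1 : MvPolynomial (Fin 1) ℝ)) := by
  apply Matrix.ext
  intro r s
  rw [Matrix.add_apply]
  by_cases hs : s = 2
  · subst hs
    rw [Matrix.mul_transvection_apply_same]
    simp [Matrix.vecMulVec_apply]
  · rw [Matrix.mul_transvection_apply_of_ne _ _ _ _ hs]
    simp [Matrix.vecMulVec_apply, hs]

/-- The garbage column is unchanged by right multiplication with a letter not in row 2. [folklore] -/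
theorem uG_mul_transvection (v : Fin 3 → (MvPolynomial (Fin 1) ℝ)) (i j : Fin 3) (hi : i ≠ 2) (c : (MvPolynomial (Fin 1) ℝ)) :
    Matrix.vecMulVec (v : Fin 3 → MvPolynomial (Fin 1) ℝ) (Pi.single (2 : Fin 3) (1 : MvPolynomial (Fin 1) ℝ)) * Matrix.transvection i j c = Matrix.vecMulVec (v : Fin 3 → MvPolynomial (Fin 1) ℝ) (Pi.single (2 : Fin 3) (1 : MvPolynomial (Fin 1) ℝ)) := by
  apply Matrix.ext
  intro r s
  by_cases hs : s = j
  · subst hs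
    rw [Matrix.mul_transvection_apply_same]
    simp [Matrix.vecMulVec_apply, hi]
  · rw [Matrix.mul_transvection_apply_of_ne _ _ _ _ hs]

/-- Garbage columns annihilate each other when the third coordinate vanishes. [folklore] -/
theorem uG_mul_uG (v w : Fin 3 → (MvPolynomial (Fin 1) ℝ)) (hw : w 2 = 0) : Matrix.vecMulVec (v : Fin 3 → MvPolynomial (Fin 1) ℝ) (Pi.single (2 : Fin 3) (1 : MvPolynomial (Fin 1) ℝ)) * Matrix.vecMulVec (w : Fin 3 → MvPolynomial (Fin 1) ℝ) (Pi.single (2 : Fin 3) (1 : MvPolynomial (Fin 1) ℝ)) = 0 := by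
  rw [Matrix.vecMulVec_mul_vecMulVec]
  simp [hw]

/-- A garbage column is absorbed on the right by a matrix whose row 2 is `e₂`. [folklore] -/
theorem uG_mul_of_row2 (v : Fin 3 → (MvPolynomial (Fin 1) ℝ)) (M : Matrix (Fin 3) (Fin 3) (MvPolynomial (Fin 1) ℝ))
    (hM : ∀ c, M 2 c = if c = 2 then 1 else 0) : Matrix.vecMulVec (v : Fin 3 → MvPolynomial (Fin 1) ℝ) (Pi.single (2 : Fin 3) (1 : MvPolynomial (Fin 1) ℝ)) * M = Matrix.vecMulVec (v : Fin 3 → MvPolynomial (Fin 1) ℝ) (Pi.single (2 : Fin 3) (1 : MvPolynomial (Fin 1) ℝ)) := by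
  rw [Matrix.vecMulVec_mul]
  congr 1
  ext c
  simp [Matrix.vecMul, dotProduct, hM c, Pi.single_apply]

/-- Row 2 of the identity is `e₂`. [folklore] -/
theorem uRow2_one : ∀ c : Fin 3, (1 : Matrix (Fin 3) (Fin 3) (MvPolynomial (Fin 1) ℝ)) 2 c = if c = 2 then 1 else 0 := by
  intro c
  rw [Matrix.one_apply]
  by_cases hc : c = 2
  · simp [hc]
  · have hc' : ¬ (2 : Fin 3) = c := fun h => hc h.symm
    simp [hc, hc']

/-- Row 2 stays `e₂` under right multiplication by letters among the indices `{0, 1}`. [folklore] -/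
theorem uRow2_mul_transvection (M : Matrix (Fin 3) (Fin 3) (MvPolynomial (Fin 1) ℝ))
    (hM : ∀ c, M 2 c = if c = 2 then 1 else 0) (i j : Fin 3)
    (hi : i ≠ 2) (hj : j ≠ 2) (c : (MvPolynomial (Fin 1) ℝ)) :
    ∀ s, (M * Matrix.transvection i j c) 2 s = if s = 2 then 1 else 0 := by
  intro s
  by_cases hs : s = j
  · subst hs
    rw [Matrix.mul_transvection_apply_same, hM, hM]
    simp [hj, hi]
  · rw [Matrix.mul_transvection_apply_of_ne _ _ _ _ hs, hM]

/-- One more double step of the walk. [folklore] -/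
theorem uA_succ (K : ℕ) : ((Matrix.transvection (0 : Fin 3) (1 : Fin 3) (MvPolynomial.X (0 : Fin 1) : MvPolynomial (Fin 1) ℝ) *
        Matrix.transvection (1 : Fin 3) (0 : Fin 3) (MvPolynomial.X (0 : Fin 1) : MvPolynomial (Fin 1) ℝ)) ^ (K + 1 : ℕ)) = ((Matrix.transvection (0 : Fin 3) (1 : Fin 3) (MvPolynomial.X (0 : Fin 1) : MvPolynomial (Fin 1) ℝ) *
        Matrix.transvection (1 : Fin 3) (0 : Fin 3) (MvPolynomial.X (0 : Fin 1) : MvPolynomial (Fin 1) ℝ)) ^ (K : ℕ)) * Matrix.transvection (0 : Fin 3) (1 : Fin 3) (MvPolynomial.X (0 : Fin 1) : MvPolynomial (Fin 1) ℝ) *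
    Matrix.transvection (1 : Fin 3) (0 : Fin 3) (MvPolynomial.X (0 : Fin 1) : MvPolynomial (Fin 1) ℝ) := by
  rw [pow_succ, mul_assoc]

/-- Row 2 of the walk matrix is `e₂`. [folklore] -/
theorem uA_row2 (K : ℕ) : ∀ c, ((Matrix.transvection (0 : Fin 3) (1 : Fin 3) (MvPolynomial.X (0 : Fin 1) : MvPolynomial (Fin 1) ℝ) *
        Matrix.transvection (1 : Fin 3) (0 : Fin 3) (MvPolynomial.X (0 : Fin 1) : MvPolynomial (Fin 1) ℝ)) ^ (K : ℕ)) 2 c = if c = 2 then 1 else 0 := by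
  induction K with
  | zero => simpa using uRow2_one
  | succ K ih =>
    rw [uA_succ]
    exact uRow2_mul_transvection _ (uRow2_mul_transvection _ ih 0 1 (by decide) (by decide) _)
      1 0 (by decide) (by decide) _

variable (W : ℕ → Fin 3 → MvPolynomial (Fin 1) ℝ)
  (hW : W 0 = Pi.single 1 1 ∧ W 1 = Pi.single 0 1 ∧
    ∀ n, W (n + 2) = W n + (MvPolynomial.X (0 : Fin 1) : MvPolynomial (Fin 1) ℝ) • W (n + 1))
include hW

/-- Columns 0 and 1 of the walk matrix are the odd/even continuant states. [folklore] -/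
theorem uA_col (K : ℕ) :
    (fun r => ((Matrix.transvection (0 : Fin 3) (1 : Fin 3) (MvPolynomial.X (0 : Fin 1) : MvPolynomial (Fin 1) ℝ) *
        Matrix.transvection (1 : Fin 3) (0 : Fin 3) (MvPolynomial.X (0 : Fin 1) : MvPolynomial (Fin 1) ℝ)) ^ (K : ℕ)) r 0) = W (2 * K + 1) ∧ (fun r => ((Matrix.transvection (0 : Fin 3) (1 : Fin 3) (MvPolynomial.X (0 : Fin 1) : MvPolynomial (Fin 1) ℝ) *
        Matrix.transvection (1 : Fin 3) (0 : Fin 3) (MvPolynomial.X (0 : Fin 1) : MvPolynomial (Fin 1) ℝ)) ^ (K : ℕ)) r 1) = W (2 * K) := by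
  induction K with
  | zero =>
    constructor
    · rw [show 2 * 0 + 1 = 1 by ring, hW.2.1]; funext r; fin_cases r <;> simp
    · rw [show 2 * 0 = 0 by ring, hW.1]; funext r; fin_cases r <;> simp
  | succ K ih =>
    obtain ⟨h0, h1⟩ := ih
    have hc1 : (fun r => (((Matrix.transvection (0 : Fin 3) (1 : Fin 3) (MvPolynomial.X (0 : Fin 1) : MvPolynomial (Fin 1) ℝ) *
        Matrix.transvection (1 : Fin 3) (0 : Fin 3) (MvPolynomial.X (0 : Fin 1) : MvPolynomial (Fin 1) ℝ)) ^ (K : ℕ)) * Matrix.transvection (0 : Fin 3) (1 : Fin 3) (MvPolynomial.X (0 : Fin 1) : MvPolynomial (Fin 1) ℝ)) r 1) = W (2 * K + 2) := by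
      funext r
      rw [Matrix.mul_transvection_apply_same, hW.2.2]
      have e0 : ((Matrix.transvection (0 : Fin 3) (1 : Fin 3) (MvPolynomial.X (0 : Fin 1) : MvPolynomial (Fin 1) ℝ) *
        Matrix.transvection (1 : Fin 3) (0 : Fin 3) (MvPolynomial.X (0 : Fin 1) : MvPolynomial (Fin 1) ℝ)) ^ (K : ℕ)) r 0 = W (2 * K + 1) r := congrFun h0 r
      have e1 : ((Matrix.transvection (0 : Fin 3) (1 : Fin 3) (MvPolynomial.X (0 : Fin 1) : MvPolynomial (Fin 1) ℝ) *
        Matrix.transvection (1 : Fin 3) (0 : Fin 3) (MvPolynomial.X (0 : Fin 1) : MvPolynomial (Fin 1) ℝ)) ^ (K : ℕ)) r 1 = W (2 * K) r := congrFun h1 r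
      simp [e0, e1, mul_comm]
    have hc0 : (fun r => (((Matrix.transvection (0 : Fin 3) (1 : Fin 3) (MvPolynomial.X (0 : Fin 1) : MvPolynomial (Fin 1) ℝ) *
        Matrix.transvection (1 : Fin 3) (0 : Fin 3) (MvPolynomial.X (0 : Fin 1) : MvPolynomial (Fin 1) ℝ)) ^ (K : ℕ)) * Matrix.transvection (0 : Fin 3) (1 : Fin 3) (MvPolynomial.X (0 : Fin 1) : MvPolynomial (Fin 1) ℝ)) r 0) = W (2 * K + 1) := by
      funext r
      rw [Matrix.mul_transvection_apply_of_ne _ _ _ _ (by decide)]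
      exact congrFun h0 r
    constructor
    · funext r
      rw [uA_succ, Matrix.mul_transvection_apply_same, show 2 * (K + 1) + 1 = (2 * K + 1) + 2 by ring,
        hW.2.2]
      have e0 : (((Matrix.transvection (0 : Fin 3) (1 : Fin 3) (MvPolynomial.X (0 : Fin 1) : MvPolynomial (Fin 1) ℝ) *
        Matrix.transvection (1 : Fin 3) (0 : Fin 3) (MvPolynomial.X (0 : Fin 1) : MvPolynomial (Fin 1) ℝ)) ^ (K : ℕ)) * Matrix.transvection (0 : Fin 3) (1 : Fin 3) (MvPolynomial.X (0 : Fin 1) : MvPolynomial (Fin 1) ℝ)) r 0 = W (2 * K + 1) r :=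
        congrFun hc0 r
      have e1 : (((Matrix.transvection (0 : Fin 3) (1 : Fin 3) (MvPolynomial.X (0 : Fin 1) : MvPolynomial (Fin 1) ℝ) *
        Matrix.transvection (1 : Fin 3) (0 : Fin 3) (MvPolynomial.X (0 : Fin 1) : MvPolynomial (Fin 1) ℝ)) ^ (K : ℕ)) * Matrix.transvection (0 : Fin 3) (1 : Fin 3) (MvPolynomial.X (0 : Fin 1) : MvPolynomial (Fin 1) ℝ)) r 1 = W (2 * K + 2) r :=
        congrFun hc1 r
      rw [e0, e1, show 2 * K + 1 + 1 = 2 * K + 2 by ring]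
      simp [mul_comm]
    · funext r
      rw [uA_succ, Matrix.mul_transvection_apply_of_ne _ _ _ _ (by decide), show 2 * (K + 1) = 2 * K + 2 by ring]
      exact congrFun hc1 r

/-- Columns of the half step `uA K · x₁(t)`. [folklore] -/
theorem uA_x1_col (K : ℕ) :
    (fun r => (((Matrix.transvection (0 : Fin 3) (1 : Fin 3) (MvPolynomial.X (0 : Fin 1) : MvPolynomial (Fin 1) ℝ) *
        Matrix.transvection (1 : Fin 3) (0 : Fin 3) (MvPolynomial.X (0 : Fin 1) : MvPolynomial (Fin 1) ℝ)) ^ (K : ℕ)) * Matrix.transvection (0 : Fin 3) (1 : Fin 3) (MvPolynomial.X (0 : Fin 1) : MvPolynomial (Fin 1) ℝ)) r 0) = W (2 * K + 1) ∧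
    (fun r => (((Matrix.transvection (0 : Fin 3) (1 : Fin 3) (MvPolynomial.X (0 : Fin 1) : MvPolynomial (Fin 1) ℝ) *
        Matrix.transvection (1 : Fin 3) (0 : Fin 3) (MvPolynomial.X (0 : Fin 1) : MvPolynomial (Fin 1) ℝ)) ^ (K : ℕ)) * Matrix.transvection (0 : Fin 3) (1 : Fin 3) (MvPolynomial.X (0 : Fin 1) : MvPolynomial (Fin 1) ℝ)) r 1) = W (2 * K + 2) := by
  obtain ⟨h0, h1⟩ := uA_col W hW K
  constructor
  · funext r
    rw [Matrix.mul_transvection_apply_of_ne _ _ _ _ (by decide)]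
    exact congrFun h0 r
  · funext r
    rw [Matrix.mul_transvection_apply_same, hW.2.2]
    have e0 : ((Matrix.transvection (0 : Fin 3) (1 : Fin 3) (MvPolynomial.X (0 : Fin 1) : MvPolynomial (Fin 1) ℝ) *
        Matrix.transvection (1 : Fin 3) (0 : Fin 3) (MvPolynomial.X (0 : Fin 1) : MvPolynomial (Fin 1) ℝ)) ^ (K : ℕ)) r 0 = W (2 * K + 1) r := congrFun h0 r
    have e1 : ((Matrix.transvection (0 : Fin 3) (1 : Fin 3) (MvPolynomial.X (0 : Fin 1) : MvPolynomial (Fin 1) ℝ) *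
        Matrix.transvection (1 : Fin 3) (0 : Fin 3) (MvPolynomial.X (0 : Fin 1) : MvPolynomial (Fin 1) ℝ)) ^ (K : ℕ)) r 1 = W (2 * K) r := congrFun h1 r
    simp [e0, e1, mul_comm]

end Walk

section WalkTranslation

/-- The walk matrix translates the state sequence: `uA J *ᵥ W n = W (2J + n)`. [folklore] -/
theorem stub_univariateWalkTranslation (W : ℕ → Fin 3 → MvPolynomial (Fin 1) ℝ)
    (hW : W 0 = Pi.single 1 1 ∧ W 1 = Pi.single 0 1 ∧
      ∀ n, W (n + 2) = W n + (MvPolynomial.X (0 : Fin 1) : MvPolynomial (Fin 1) ℝ) • W (n + 1)) (J : ℕ) : ∀ n, Matrix.mulVec ((Matrix.transvection (0 : Fin 3) (1 : Fin 3) (MvPolynomial.X (0 : Fin 1) : MvPolynomial (Fin 1) ℝ) *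
        Matrix.transvection (1 : Fin 3) (0 : Fin 3) (MvPolynomial.X (0 : Fin 1) : MvPolynomial (Fin 1) ℝ)) ^ (J : ℕ)) (W n) = W (2 * J + n) := by
  intro n
  induction n using Nat.strong_induction_on with
  | _ n ih =>
    match n, ih with
    | 0, _ =>
      rw [hW.1, Matrix.mulVec_single_one, add_zero, ← (uA_col W hW J).2]
      rfl
    | 1, _ =>
      rw [hW.2.1, Matrix.mulVec_single_one, ← (uA_col W hW J).1]
      rfl
    | (n + 2), ih =>
      rw [hW.2.2, Matrix.mulVec_add, Matrix.mulVec_smul, ih n (by omega), ih (n + 1) (by omega),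
        show 2 * J + (n + 2) = (2 * J + n) + 2 by ring, hW.2.2, show 2 * J + (n + 1) = 2 * J + n + 1 by ring]

end WalkTranslation

end Summit.ValiantsHypothesis.ValiantsHypothesis.Cruxes.WordLengthQP.PositiveMonoidExits

end
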